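import Literature.Probability.Percolation.HutchcroftVolumeTail
import Literature.Probability.Percolation.SusceptibilityGammaOne
import Summits.CriticalPhenomena.PercolationContinuityZ3.Theorems.PercNearOneGluingNoHeavyQuantThetaModulusR4
import HarnessLib

/-!
# A TWO-SIDED transfer: the subcritical susceptibility bounds `θ` above `p_c`,
# `θ(p) ≤ 8d (p−q)² χ(q) / (q (1−p)²)` (`q < p_c ≤ p`), hence `θ(p_c + s) ≤ K_d s² χ(p_c − s)` and
# "subcritical `χ(p_c − s) ≤ M s^{−g}` with `g < 2` ⇒ `ThetaHolderNearCritical d (2 − g) C`" (`β ≥ 2 − γ`) — quant lane, rung R4, seat p4 gen 4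

builds on p205010 (kernel theorem, internal audit signed; external expert review pending).
Status sentence for p205010: "θ(p_c) = 0 on ℤ^d, all d ≥ 2 — kernel-verified (Lean 4/Mathlib, standard
axioms); internal adversarial audit SIGNED 2026-08-20 04:29Z; external expert review pending."

Seat `prim-quant-p4` (METHOD = differential inequalities for `θ` near `p_c`), `--supports stmt-CriticalPhenomena-4575`;
pure proofs, no definitions.  The differential inequality is Hutchcroft's relative-entropy bound (Hutchcroft 2022, Thm. 1.3,
a THEOREM of the tree: `Hutchcroft2022_thm13_holds`): `P_{β₂}(|C| ≥ n) ≤ 2 P_{β₁}(|C| ≥ n) + (4/β₁)(β₂−β₁)² Σ_{k≤n} P_{β₁}(|C| ≥ k)`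
(`p = 1 − e^{−β/(2d)}`).  The tree uses it between a SUBCRITICAL `p₁ = p_c − ε` and `p ≤ p_c + ε` inside the proof of
`theta_le_linear_of_gamma_hutchcroft` (`γ = 1 ⇒ β = 1` under the triangle condition); here the same step is exported as a
stand-alone, hypothesis-free inequality in the lane's vocabulary and read as a third architecture for (T2):

* `theta_le_sq_mul_chi` — **for `0 < q < p_c`, `q ≤ p < 1`: `θ(p) ≤ 8d (p − q)²/(q (1 − p)²) · χ(q)`**, `χ(q) = chi d q = Σ_x τ_q(0,x)`
  (finite below `p_c`): let `n → ∞` in Hutchcroft's inequality (`P_p(|C| ≥ n) → θ(p)`, `θ(q) = 0`, `Σ_{k≤n} P_q(|C| ≥ k) ≤ χ(q)`)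
  and bound `4/β₁ ≤ 2/(d q)`, `β₂ − β₁ ≤ 2d (p−q)/(1−p)` (`hutchcroft_beta_estimates`);
* `theta_le_sq_mul_chi_critical` — at the symmetric points: `θ(p) ≤ (256 d/(p_c (1−p_c)²)) s² χ(p_c − s)` for
  `p_c ≤ p ≤ p_c + s`, `0 < s ≤ min(p_c, 1−p_c)/2`: the modulus of `θ` at `p_c⁺` is controlled by the divergence of the
  susceptibility at `p_c⁻`;
* `thetaHolderNearCritical_of_chiSubcritical` — **a subcritical power bound `χ(q) ≤ M (p_c − q)^{−g}` on `(p_c − δ₀, p_c)` with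
  `g < 2` gives `Quant.ThetaHolderNearCritical d (2 − g) C`** with `C` explicit: in exponent language `β ≥ 2 − γ`, sharp in
  mean field (`γ = 1 ⇒ β ≥ 1`; this is exactly how the tree derives Barsky–Aizenman's `β = 1` from Aizenman–Newman's `γ = 1`).

Honest reading (repair census, P4-MODULUS §3/§9, variant V11): for `d = 3` no power UPPER bound on `χ` below `p_c` is in print
(`γ < ∞` is open for `3 ≤ d ≤ 6`; the tree has only the mean-field LOWER bound `χ(p) ≥ 1/(2d(p_c − p))`,
`AizenmanNewman1984_chi_lower_holds`), so this architecture, like the one-arm (R4.b) and volume (Newman) ones, gives NO rate at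
`d = 3`; it converts a hypothetical subcritical rate with `γ' < 2` (numerically `γ ≈ 1.8` in `d = 3`, orientation only) into
(T2) with exponent `2 − γ'`.  Nothing here changes the `d = 3` class of the lane's unconditional results.

## References
* T. Hutchcroft, *On the derivation of mean-field percolation critical exponents from the triangle condition*, J. Stat. Phys.
  189 (2022) no. 6, Thm. 1.3 and §1.1 [Hutchcroft2022Triangle].
* G. Grimmett, *Percolation*, 2nd ed. (1999), §1.5 (1.19) (`χ`), §10.2 [GrimmettPercolation1999].
-/

noncomputable section

namespace Summit.CriticalPhenomena.PercolationContinuityZ3.Theorems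

namespace ThetaModulus

open MeasureTheory Set Filter Topology Literature.Probability.Percolation Literature.Probability.LatticeModels
open scoped Classical ENNReal

variable {d : ℕ}

/-! ### §1. `θ(p) ≤ 8d (p−q)² χ(q) / (q (1−p)²)` for `q < p_c`, `q ≤ p < 1` -/

/-- **The subcritical susceptibility bounds `θ` above it.**  For `d ≥ 2`, `0 < q < p_c(ℤ^d)` and `q ≤ p < 1`:
`θ(p) ≤ 8d (p − q)² / (q (1 − p)²) · χ(q)`, `χ(q) = Σ_x τ_q(0,x)` (the tree's `chi d q`, `= E_q|C(0)|` below `p_c`).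
Proof: Hutchcroft's Thm. 1.3 (`Hutchcroft2022_thm13_holds`) between `β₁ = −2d log(1−q)` and `β₂ = −2d log(1−p)` for every
`n`, `Σ_{k≤n} P_q(|C| ≥ k) ≤ χ(q)` (`ofReal_sum_real_clusterSizeGe_le`, `expClusterSize_eq_ofReal_chi`), `n → ∞`
(`tendsto_real_clusterSizeGe`, `θ(q) = 0`), and `4/β₁ ≤ 2/(dq)`, `β₂ − β₁ ≤ 2d(p−q)/(1−p)` (`hutchcroft_beta_estimates`).
New as a stand-alone statement (the step is inside the tree's `theta_le_linear_of_gamma_hutchcroft`).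
[cite: Hutchcroft2022Triangle, Thm. 1.3 and §1.1 (deduction of (1.3) from (1.1))] -/
theorem theta_le_sq_mul_chi (hd : 2 ≤ d) (q p : unitInterval) (hq0 : 0 < (q : ℝ))
    (hqc : (q : ℝ) < (criticalProbI d : ℝ)) (hqp : (q : ℝ) ≤ p) (hp1 : (p : ℝ) < 1) :
    theta (zdGraph d) 0 p ≤
      8 * d * ((p : ℝ) - q) ^ 2 / ((q : ℝ) * (1 - (p : ℝ)) ^ 2) * chi d q := by
  have hd1 : 1 ≤ d := by omega
  have hdR : (0 : ℝ) < d := by exact_mod_cast (show 0 < d by omega)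
  have hqc' : (q : ℝ) < criticalProb (zdGraph d) (0 : Site d) := by rwa [coe_criticalProbI] at hqc
  have hq1 : (q : ℝ) < 1 := lt_of_le_of_lt hqp hp1
  -- Hutchcroft parameters
  set β₁ : ℝ := -(2 * d) * Real.log (1 - q) with hβ₁
  set β₂ : ℝ := -(2 * d) * Real.log (1 - p) with hβ₂
  obtain ⟨hβ₁low, hβ₁₂, hβdiff⟩ := hutchcroft_beta_estimates d hqp hp1
  have hβ₁pos : 0 < β₁ := lt_of_lt_of_le (by positivity) hβ₁low
  have hP₁ : hutchcroftParam d β₁ = q := hutchcroftParam_neg_log hd1 q hq1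
  have hP₂ : hutchcroftParam d β₂ = p := hutchcroftParam_neg_log hd1 p hp1
  -- `χ(q)` bounds the partial sums of the volume profile
  have hχ1 : 1 ≤ chi d q := one_le_chi hd q hqc'
  have hχ0 : 0 ≤ chi d q := zero_le_one.trans hχ1
  have hχsum : ∀ n : ℕ, ∑ k ∈ Finset.Icc 1 n,
      (bondPercolation (zdGraph d) q).real (clusterSizeGe (0 : Site d) k) ≤ chi d q := by
    intro n
    have h := ofReal_sum_real_clusterSizeGe_le (zdGraph d) (0 : Site d) q n
    rw [expClusterSize_eq_ofReal_chi hd q hqc'] at h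
    exact (ENNReal.ofReal_le_ofReal_iff hχ0).1 h
  -- Hutchcroft's inequality for every `n`
  have hH : ∀ n : ℕ, (bondPercolation (zdGraph d) p).real (clusterSizeGe (0 : Site d) n) ≤
      2 * (bondPercolation (zdGraph d) q).real (clusterSizeGe (0 : Site d) n) +
        4 / β₁ * (β₂ - β₁) ^ 2 * chi d q := by
    intro n
    have h := Hutchcroft2022_thm13_holds d hd1 β₁ β₂ hβ₁pos hβ₁₂ n
    rw [hP₁, hP₂] at h
    refine h.trans (add_le_add le_rfl ?_)
    exact mul_le_mul_of_nonneg_left (hχsum n) (by positivity)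
  -- `n → ∞`
  have hlim : theta (zdGraph d) 0 p ≤
      2 * theta (zdGraph d) 0 q + 4 / β₁ * (β₂ - β₁) ^ 2 * chi d q :=
    le_of_tendsto_of_tendsto' (tendsto_real_clusterSizeGe (zdGraph d) 0 p)
      (((tendsto_real_clusterSizeGe (zdGraph d) 0 q).const_mul 2).add tendsto_const_nhds) hH
  have hθq : theta (zdGraph d) 0 q = 0 :=
    theta_eq_zero_of_lt_criticalProb_holds (zdGraph d) 0 q hqc'
  rw [hθq, mul_zero, zero_add] at hlim
  -- the constants
  have h1 : 4 / β₁ ≤ 4 / (2 * d * (q : ℝ)) :=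
    div_le_div_of_nonneg_left (by norm_num) (by positivity) hβ₁low
  have hdiff0 : 0 ≤ β₂ - β₁ := by linarith
  have h2 : (β₂ - β₁) ^ 2 ≤ (2 * d * (((p : ℝ) - q) / (1 - p))) ^ 2 := pow_le_pow_left₀ hdiff0 hβdiff 2
  have h1p : 0 < 1 - (p : ℝ) := by linarith
  calc theta (zdGraph d) 0 p ≤ 4 / β₁ * (β₂ - β₁) ^ 2 * chi d q := hlim
    _ ≤ 4 / (2 * d * (q : ℝ)) * (2 * d * (((p : ℝ) - q) / (1 - p))) ^ 2 * chi d q := by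
        apply mul_le_mul_of_nonneg_right _ hχ0
        exact mul_le_mul h1 h2 (sq_nonneg _) (by positivity)
    _ = 8 * d * ((p : ℝ) - q) ^ 2 / ((q : ℝ) * (1 - (p : ℝ)) ^ 2) * chi d q := by
        congr 1
        field_simp
        ring

/-! ### §2. At `p_c`: `θ(p) ≤ (256 d/(p_c (1−p_c)²)) s² χ(p_c − s)` for `p_c ≤ p ≤ p_c + s` -/

/-- **The modulus of `θ` at `p_c⁺` is controlled by the susceptibility at `p_c⁻`.**  For `d ≥ 2`,
`0 < s ≤ min(p_c, 1 − p_c)/2`, the subcritical point `q = p_c − s` and any `p_c ≤ p ≤ p_c + s`: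
`θ(p) ≤ (256 d / (p_c (1 − p_c)²)) · s² · χ(p_c − s)` (`theta_le_sq_mul_chi` with `p − q ≤ 2s`, `q ≥ p_c/2`,
`1 − p ≥ (1 − p_c)/2`).  Two-sided in the sense sub ↔ super-critical; explicit modulo the subcritical susceptibility.  New.
[cite: Hutchcroft2022Triangle, §1.1 (β₁ = β_c − ε, β₂ = β_c + ε)] -/
theorem theta_le_sq_mul_chi_critical (hd : 2 ≤ d) {s : ℝ} (hs0 : 0 < s)
    (hs1 : s ≤ (criticalProbI d : ℝ) / 2) (hs2 : s ≤ (1 - (criticalProbI d : ℝ)) / 2)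
    (q : unitInterval) (hq : (q : ℝ) = criticalProbI d - s)
    (p : unitInterval) (hp : (criticalProbI d : ℝ) ≤ p) (hps : (p : ℝ) ≤ criticalProbI d + s) :
    theta (zdGraph d) 0 p ≤
      256 * d / ((criticalProbI d : ℝ) * (1 - criticalProbI d) ^ 2) * s ^ 2 * chi d q := by
  set pc := (criticalProbI d : ℝ) with hpcdef
  have hpc0 : 0 < pc := by rw [hpcdef, coe_criticalProbI]; exact criticalProb_zd_pos d (by omega)
  have hpc1 : pc < 1 := by rw [hpcdef, coe_criticalProbI]; exact criticalProb_zd_lt_one hd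
  have hdR : (0 : ℝ) < d := by exact_mod_cast (show 0 < d by omega)
  have hq0 : 0 < (q : ℝ) := by rw [hq]; linarith
  have hqc : (q : ℝ) < pc := by rw [hq]; linarith
  have hqp : (q : ℝ) ≤ p := by rw [hq]; linarith
  have hp1 : (p : ℝ) < 1 := by linarith
  have hmain := theta_le_sq_mul_chi hd q p hq0 hqc hqp hp1
  have hχ0 : 0 ≤ chi d q := zero_le_one.trans (one_le_chi hd q (by rwa [hpcdef, coe_criticalProbI] at hqc))
  -- compare the prefactors
  have hpq : ((p : ℝ) - q) ^ 2 ≤ (2 * s) ^ 2 := by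
    apply pow_le_pow_left₀ (by linarith)
    rw [hq]; linarith
  have hqlow : pc / 2 ≤ (q : ℝ) := by rw [hq]; linarith
  have h1plow : (1 - pc) / 2 ≤ 1 - (p : ℝ) := by linarith
  have hden : pc / 2 * ((1 - pc) / 2) ^ 2 ≤ (q : ℝ) * (1 - (p : ℝ)) ^ 2 :=
    mul_le_mul hqlow (pow_le_pow_left₀ (by linarith) h1plow 2) (by positivity) (by linarith)
  have hden0 : 0 < pc / 2 * ((1 - pc) / 2) ^ 2 := by
    have : 0 < 1 - pc := by linarith
    positivity
  calc theta (zdGraph d) 0 p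
      ≤ 8 * d * ((p : ℝ) - q) ^ 2 / ((q : ℝ) * (1 - (p : ℝ)) ^ 2) * chi d q := hmain
    _ ≤ 8 * d * (2 * s) ^ 2 / (pc / 2 * ((1 - pc) / 2) ^ 2) * chi d q := by
        apply mul_le_mul_of_nonneg_right _ hχ0
        calc 8 * d * ((p : ℝ) - q) ^ 2 / ((q : ℝ) * (1 - (p : ℝ)) ^ 2)
            ≤ 8 * d * (2 * s) ^ 2 / ((q : ℝ) * (1 - (p : ℝ)) ^ 2) :=
              div_le_div_of_nonneg_right (mul_le_mul_of_nonneg_left hpq (by positivity)) (by positivity)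
          _ ≤ 8 * d * (2 * s) ^ 2 / (pc / 2 * ((1 - pc) / 2) ^ 2) :=
              div_le_div_of_nonneg_left (by positivity) hden0 hden
    _ = 256 * d / (pc * (1 - pc) ^ 2) * s ^ 2 * chi d q := by
        congr 1
        field_simp
        ring

/-! ### §3. A subcritical power bound on `χ` gives a Hölder modulus: `β ≥ 2 − γ` in the lane's vocabulary -/

/-- **Subcritical susceptibility rate ⇒ (T2).**  If `χ(q) ≤ M (p_c − q)^{−g}` for all `q ∈ (p_c − δ₀, p_c)` with
`g < 2` (`δ₀ > 0`; `g ≥ 1` is forced by the mean-field bound `χ(q) ≥ 1/(2d(p_c − q))`), then for every `p ≥ p_c`: `θ(p) ≤ C (p − p_c)^{2−g}` with the explicit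
`C = (256 d/(p_c(1−p_c)²)) M + (1/m)^{2−g}`, `m = min(δ₀, min(p_c, 1−p_c)/2)`, i.e.
`Quant.ThetaHolderNearCritical d (2 − g) C` (near `p_c`: `theta_le_sq_mul_chi_critical` at `s = p − p_c` and
`s² · s^{−g} = s^{2−g}`; beyond `p_c + m`: `θ ≤ 1`; at `p_c`: `θ(p_c) = 0`, p205010).  In exponent language `β ≥ 2 − γ`;
sharp in mean field (`γ = 1`, `β = 1`).  CONDITIONAL on a subcritical power bound, which for `3 ≤ d ≤ 6` is not in print
(`γ < ∞` open); the reduction is new.  builds on p205010 (kernel theorem, internal audit signed; external expert review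
pending) (only at `p = p_c`). [cite: Hutchcroft2022Triangle, §1.1 (deduction of (1.3) from (1.1))] -/
theorem thetaHolderNearCritical_of_chiSubcritical (hd : 2 ≤ d) {M g δ₀ : ℝ} (hg2 : g < 2) (hδ₀ : 0 < δ₀)
    (hχ : ∀ q : unitInterval, (criticalProbI d : ℝ) - δ₀ < q → (q : ℝ) < criticalProbI d →
      chi d q ≤ M * ((criticalProbI d : ℝ) - q) ^ (-g)) :
    Quant.ThetaHolderNearCritical d (2 - g)
      (256 * d / ((criticalProbI d : ℝ) * (1 - criticalProbI d) ^ 2) * M +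
        (1 / min δ₀ (min (criticalProbI d : ℝ) (1 - criticalProbI d) / 2)) ^ (2 - g)) := by
  intro p hp
  set pc := (criticalProbI d : ℝ) with hpcdef
  have hpc0 : 0 < pc := by rw [hpcdef, coe_criticalProbI]; exact criticalProb_zd_pos d (by omega)
  have hpc1 : pc < 1 := by rw [hpcdef, coe_criticalProbI]; exact criticalProb_zd_lt_one hd
  have hdR : (0 : ℝ) < d := by exact_mod_cast (show 0 < d by omega)
  have hb0 : 0 < 2 - g := by linarith
  set m : ℝ := min δ₀ (min pc (1 - pc) / 2) with hm
  have hm0 : 0 < m := lt_min hδ₀ (by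
    have : 0 < min pc (1 - pc) := lt_min hpc0 (by linarith)
    linarith)
  have hmδ : m ≤ δ₀ := min_le_left _ _
  have hmpc : m ≤ pc / 2 := (min_le_right _ _).trans (by
    have := min_le_left pc (1 - pc); linarith)
  have hm1 : m ≤ (1 - pc) / 2 := (min_le_right _ _).trans (by
    have := min_le_right pc (1 - pc); linarith)
  set K : ℝ := 256 * d / (pc * (1 - pc) ^ 2) with hK
  have hK0 : 0 < K := by
    have : 0 < pc * (1 - pc) ^ 2 := mul_pos hpc0 (pow_pos (by linarith) 2)
    rw [hK]; positivity
  -- `M > 0`: test the hypothesis at `q = pc - m/2`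
  have hM0 : 0 < M := by
    set q : unitInterval := ⟨pc - m / 2, ⟨by linarith, by linarith⟩⟩ with hqdef
    have hq1 : pc - δ₀ < (q : ℝ) := by show pc - δ₀ < pc - m / 2; linarith
    have hq2 : (q : ℝ) < pc := by show pc - m / 2 < pc; linarith
    have h := hχ q hq1 hq2
    have hχ1 : 1 ≤ chi d q := one_le_chi hd q (by rw [← coe_criticalProbI]; exact hq2)
    have hpow : 0 < (pc - (q : ℝ)) ^ (-g) := Real.rpow_pos_of_pos (by linarith) _
    by_contra hM
    push Not at hM
    have : M * (pc - (q : ℝ)) ^ (-g) ≤ 0 := mul_nonpos_of_nonpos_of_nonneg hM hpow.le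
    linarith
  set K₂ : ℝ := (1 / m) ^ (2 - g) with hK₂
  have hK₂0 : 0 ≤ K₂ := Real.rpow_nonneg (by positivity) _
  have hKM0 : 0 ≤ K * M := (mul_pos hK0 hM0).le
  have hs0 : 0 ≤ (p : ℝ) - pc := by rw [hpcdef]; linarith
  have hsb0 : 0 ≤ ((p : ℝ) - pc) ^ (2 - g) := Real.rpow_nonneg hs0 _
  rcases hp.eq_or_lt with heq | hlt
  · -- `p = p_c`
    have hp' : p = criticalProbI d := Subtype.ext heq.symm
    have h0 : theta (zdGraph d) 0 p = 0 := by
      rw [hp']; exact CSH.percolationContinuity_allDimensions d hd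
    rw [h0]
    exact mul_nonneg (add_nonneg hKM0 hK₂0) hsb0
  by_cases hnear : (p : ℝ) - pc < m
  · -- near `p_c`: `s = p - p_c < m`
    set s : ℝ := (p : ℝ) - pc with hs
    have hs0' : 0 < s := by rw [hs]; linarith
    set q : unitInterval := ⟨pc - s, ⟨by linarith, by linarith⟩⟩ with hqdef
    have hmain := theta_le_sq_mul_chi_critical hd hs0' (by linarith) (by linarith) q rfl p hlt.le
      (by rw [hs]; linarith)
    have hχq : chi d q ≤ M * s ^ (-g) := by
      have h := hχ q (by show pc - δ₀ < pc - s; linarith) (by show pc - s < pc; linarith)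
      have : pc - (q : ℝ) = s := by show pc - (pc - s) = s; ring
      rwa [this] at h
    have hss : s ^ 2 * s ^ (-g) = s ^ (2 - g) := by
      rw [← Real.rpow_natCast s 2, ← Real.rpow_add hs0']
      norm_num
      ring_nf
    calc theta (zdGraph d) 0 p ≤ K * s ^ 2 * chi d q := hmain
      _ ≤ K * s ^ 2 * (M * s ^ (-g)) := mul_le_mul_of_nonneg_left hχq (by positivity)
      _ = K * M * (s ^ 2 * s ^ (-g)) := by ring
      _ = K * M * s ^ (2 - g) := by rw [hss]
      _ ≤ (K * M + K₂) * s ^ (2 - g) := by nlinarith [Real.rpow_nonneg hs0'.le (2 - g)]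
  · -- far from `p_c`: `θ ≤ 1 ≤ K₂ (p - p_c)^{2-g}`
    push Not at hnear
    have hge1 : 1 ≤ 1 / m * ((p : ℝ) - pc) := by
      rw [div_mul_eq_mul_div, one_mul, le_div_iff₀ hm0]; linarith
    have hK₂s : 1 ≤ K₂ * ((p : ℝ) - pc) ^ (2 - g) := by
      rw [hK₂, ← Real.mul_rpow (by positivity) hs0]
      exact Real.one_le_rpow hge1 hb0.le
    calc theta (zdGraph d) 0 p ≤ 1 := theta_le_one _ _ _
      _ ≤ K₂ * ((p : ℝ) - pc) ^ (2 - g) := hK₂s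
      _ ≤ (K * M + K₂) * ((p : ℝ) - pc) ^ (2 - g) := by nlinarith

/-- Existential form: a subcritical power bound on `χ` with exponent `g < 2` gives `∃ C, ThetaHolderNearCritical d (2 − g) C`
(`β ≥ 2 − γ` in the lane's vocabulary).  Conditional; new. [cite: Hutchcroft2022Triangle, §1.1] -/
theorem exists_thetaHolderNearCritical_of_chiSubcritical (hd : 2 ≤ d) {g : ℝ} (hg2 : g < 2)
    (h : ∃ M δ₀ : ℝ, 0 < δ₀ ∧ ∀ q : unitInterval, (criticalProbI d : ℝ) - δ₀ < q → (q : ℝ) < criticalProbI d →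
      chi d q ≤ M * ((criticalProbI d : ℝ) - q) ^ (-g)) :
    ∃ C : ℝ, Quant.ThetaHolderNearCritical d (2 - g) C := by
  obtain ⟨M, δ₀, hδ₀, hχ⟩ := h
  exact ⟨_, thetaHolderNearCritical_of_chiSubcritical hd hg2 hδ₀ hχ⟩

end ThetaModulus

end Summit.CriticalPhenomena.PercolationContinuityZ3.Theorems
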